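/-
Copyright: the b2b-balaban T⁴-continuum CRUX team, row NE7b owner lineage `t4-ne7b-p1` (gen 111). Project licence.
-/
import Literature.MathematicalPhysics.QuantumFieldTheory.Balaban1983to89.B4Ineq115Torus

/-!
# BAŁABAN's SCALAR SOFT TOWER ON THE TORUS INHABITS THE REGION LETTERS AT EVERY LEVEL: for the concrete tower `B1RG242Torus.tower`
# (block averagings `Q`, fluctuation weights `a_j = B1.aSeq a L j`) and its rescaled effective form `Δ^{(j)} = B5Display136Torus.Drs` on
# the unit lattice `T₁^{(j)} = Site P j`: ceiling `⟨ψ, Δ^{(j)}ψ⟩ ≤ a_j‖ψ‖² ≤ a‖ψ‖²` on all fields and floor `γ_u(L,a)·‖ψ‖² ≤ ⟨ψ, Δ^{(j)}ψ⟩`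
# on the kernel of the NEXT averaging `Q_j`, with `γ_u = B4Ineq115Torus.gamma115u L a` LEVEL-FREE — so the ratio «size ∕ kernel coercivity»
# of the soft flow is `≤ a ∕ γ_u(L, a)` at EVERY level (`= 24` at `L = 2` for every `0 < a ≤ 8`)
# (row NE7b, node U5c; a JUNCTION ∕ census certificate on the tree's `B4Ineq115Torus` (1.15) BY NAME — nothing new of print's; [folklore] algebra)

Cell `pub-balaban`, sub-cell `t4`, spine estimate NE7b (`T4WeightBudget.RelWeightBound`; the cell's OWN estimate — NOT PRINTED in [Bałaban 1983–89],
NOT PROVED).  Crux-route work under `Spine/NE7b/` by the row OWNER (`t4-ne7b-p1` gen 111) under FREEZE (0)'s crux-prover clause; NOTHING of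
Bałaban's is asserted: every input is a KERNEL theorem of the tree's `B4Ineq115Torus` ∕ `B1RG242Torus` ∕ `B1` (the typed scalar torus tower of
[Balaban1982Higgs1] (2.7)–(2.31) and the (1.15) bounds of [Balaban1983RegularityDecay], proved there for `U = 1`); no `T4Continuum/Support` leaf
typed; no `def`; zero `sorry`.  Import: `Literature.….B4Ineq115Torus` ONLY (built; leaf-04 g149's `…BlockPoincareFibreFloorScalarTower` imports it too).

WHY (owner reading R-ne7bp1-g111-1 ∕ companion of `…FreeFieldBlockingLetters`, which treats the HARD flow on `ℤ^d`).  The pricing desk's REGION end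
(PRICING-NE7b v119 §3 (ii): «`B ≤ β·m` ALIVE by value») asks, per scale, a CEILING of the transported form and its COERCIVITY ON THE KERNEL OF THE
NEXT AVERAGING, with ONE `β` for all scales.  Print's renormalisation steps are SOFT (Gaussian averaging with weight `a L^{−2}`, [Balaban1982Higgs1]
(2.19)–(2.21)); for the scalar `U = 1` soft tower the tree's `B4Ineq115Torus` proves (1.15) on the torus with LEVEL-FREE constants:
`form_Drs_nonneg ∕ form_Drs_le` (`0 ≤ ⟨ψ, Δ^{(j)}ψ⟩ ≤ a_j‖ψ‖²`) and `ineq115_lower_uniform` (`γ_u‖ψ‖² ≤ ⟨ψ, (aL^{−2}Q^*Q + Δ^{(j)})ψ⟩`).  On the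
kernel of the next averaging `Q_j` the `Q^*Q` term VANISHES, so the floor is a floor of `Δ^{(j)}` itself there: THIS FILE records that two-line
consequence as the soft flow's region letters — a finite REAL carrier (`Site P j → ℝ`, `dotProduct`, `Matrix.mulVec`), ready for the normed-space
junction of W-ne7bp1-g111-2 (`EuclideanSpace ℝ (Site P j)`).

WHAT IS PROVED (`P : Params` the tower's parameters (`L ≥ 2`, `d`), `a > 0`, `m² ≥ 0`, level `j ≥ 1`; [folklore] algebra over the named theorems):
* §1 `form_QsQ_eq_zero_of_Q_zero` (`Q_j ψ = 0 ⟹ ⟨ψ, Q^*Qψ⟩ = 0`), `form_Carg_eq_form_Drs_of_Q_zero` (`Q_j ψ = 0 ⟹ ⟨ψ,(aL^{−2}Q^*Q + Δ^{(j)})ψ⟩ = ⟨ψ, Δ^{(j)}ψ⟩`).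
* §2 **`form_Drs_ge_of_Q_zero`** (`Q_j ψ = 0 ⟹ γ_u(L,a)·‖ψ‖² ≤ ⟨ψ, Δ^{(j)}ψ⟩`), **`form_Drs_le_a`** (`⟨ψ, Δ^{(j)}ψ⟩ ≤ a·‖ψ‖²`, from `a_j ≤ a`).
* §3 **`softTower_regionLetters`** — the conjunction for EVERY level `j ≥ 1`: ceiling `a` on all `ψ`, floor `γ_u(L, a) > 0` on `ker Q_j`; and
  **`softTower_regionRatio`**: for every `φ` and every `ψ ∈ ker Q_j`, `γ_u·⟨φ, Δ^{(j)}φ⟩·‖ψ‖² ≤ a·⟨ψ, Δ^{(j)}ψ⟩·‖φ‖²` (the ceiling at `φ` against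
  the floor at `ψ`, nothing divided).
* §4 toy: at `L = 2` the level-free ratio bound `a ∕ γ_u(2, a)` equals `64a∕(3·min 8 a) + 8∕3`, `= 24` for `0 < a ≤ 8` (`ratio_L2`); compare the
  HARD flow's exact `x_B* = 25.177` (desk F698) and `…FreeFieldBlockingLetters`' certificate `< 1504`.

NOT HERE (honest): covariant `U ≠ 1` towers; the hard flow (`…FreeFieldBlockingLetters`, `ℤ^d`); the normed-space junction (W-ne7bp1-g111-2, a leaf);
anything of Bałaban's beyond the tree's kernel theorems ((A3) ∕ (A1c), NC-NE7b-α UNRULED).  BY-NAME EFFECT ON THE WALL: NONE.  NE7b NOT PRINTED ∕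
NOT PROVED; spine PROVED 0∕9; rung (B)+1 on a FINITE torus — NOT infinite volume, NOT the mass gap, NOT Clay.  HONEST DEPENDENCY: continuum YM on
T⁴ ⇐ BetaPertH ∧ nine spine estimates (0∕9 proved); BetaPertH ⇐ (D1) ∧ (D4) ∧ CAP+tail; G-an2-4 gates asym, D1 and NE2∕3∕4.
-/

set_option autoImplicit false

namespace Summit.QuantumFields.BalabanUV.T4Continuum.NE7b.SoftTowerRegionLetters

open Matrix
open Literature.MathematicalPhysics.QuantumFieldTheory.Balaban1983to89
open B1RG242Torus B5Display136Torus B4Ineq115Torus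

variable {P : Params}

/-! ## §1. On the kernel of the next averaging the `Q^*Q` term vanishes -/

/-- `Q_j ψ = 0 ⟹ ⟨ψ, Q^*_jQ_jψ⟩ = 0`. [folklore] -/
theorem form_QsQ_eq_zero_of_Q_zero (j : ℕ) (ψ : Site P j → ℝ) (hψ : Q P j *ᵥ ψ = 0) :
    ψ ⬝ᵥ ((Qs P j * Q P j) *ᵥ ψ) = 0 := by
  rw [← Matrix.mulVec_mulVec, hψ, Matrix.mulVec_zero, dotProduct_zero]

/-- `Q_j ψ = 0 ⟹ ⟨ψ, (aL^{−2}Q^*Q + Δ^{(j)})ψ⟩ = ⟨ψ, Δ^{(j)}ψ⟩`. [folklore] -/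
theorem form_Carg_eq_form_Drs_of_Q_zero (a msq : ℝ) (j : ℕ) (ψ : Site P j → ℝ) (hψ : Q P j *ᵥ ψ = 0) :
    ψ ⬝ᵥ (Carg P a msq j *ᵥ ψ) = ψ ⬝ᵥ (Drs P a msq j *ᵥ ψ) := by
  rw [Carg, Matrix.add_mulVec, dotProduct_add, Matrix.smul_mulVec, dotProduct_smul,
    form_QsQ_eq_zero_of_Q_zero j ψ hψ, smul_zero, zero_add]

/-! ## §2. The floor on the kernel and the level-free ceiling -/

/-- **FLOOR ON THE KERNEL OF THE NEXT AVERAGING, LEVEL-FREE**: `Q_j ψ = 0 ⟹ γ_u(L, a)·‖ψ‖² ≤ ⟨ψ, Δ^{(j)}ψ⟩` (`j ≥ 1`) —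
`B4Ineq115Torus.ineq115_lower_uniform` read on `ker Q_j`. [folklore] -/
theorem form_Drs_ge_of_Q_zero {a msq : ℝ} (ha : 0 < a) (hm : 0 ≤ msq) {j : ℕ} (hj : 1 ≤ j) (ψ : Site P j → ℝ)
    (hψ : Q P j *ᵥ ψ = 0) : gamma115u P.L a * (ψ ⬝ᵥ ψ) ≤ ψ ⬝ᵥ (Drs P a msq j *ᵥ ψ) := by
  rw [← form_Carg_eq_form_Drs_of_Q_zero a msq j ψ hψ]
  exact ineq115_lower_uniform ha hm hj ψ

/-- **CEILING, LEVEL-FREE**: `⟨ψ, Δ^{(j)}ψ⟩ ≤ a·‖ψ‖²` for every `ψ` (`form_Drs_le` and `a_j ≤ a`, `B1.aSeq_le`). [folklore] -/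
theorem form_Drs_le_a {a msq : ℝ} (ha : 0 < a) (hm : 0 ≤ msq) {j : ℕ} (hj : 1 ≤ j) (ψ : Site P j → ℝ) :
    ψ ⬝ᵥ (Drs P a msq j *ᵥ ψ) ≤ a * (ψ ⬝ᵥ ψ) :=
  (form_Drs_le ha hm hj ψ).trans
    (mul_le_mul_of_nonneg_right (B1.aSeq_le ha (one_lt_cast_L P) j hj) (dot_self_nonneg ψ))

/-! ## §3. The region letters of the soft flow, every level -/

/-- **THE SOFT TOWER's REGION LETTERS, EVERY LEVEL `j ≥ 1`**: the effective form `Δ^{(j)}` is nonnegative and `≤ a·‖ψ‖²` on all fields, and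
`≥ γ_u(L,a)·‖ψ‖²` with `γ_u(L,a) > 0` on the kernel of the next averaging `Q_j` — ONE pair of constants `(a, γ_u(L, a))` for all levels
(the desk's ratio `x_B ≤ a∕γ_u(L, a)` at every scale of the soft flow). [folklore] -/
theorem softTower_regionLetters {a msq : ℝ} (ha : 0 < a) (hm : 0 ≤ msq) {j : ℕ} (hj : 1 ≤ j) :
    0 < gamma115u P.L a ∧
      (∀ ψ : Site P j → ℝ, 0 ≤ ψ ⬝ᵥ (Drs P a msq j *ᵥ ψ) ∧ ψ ⬝ᵥ (Drs P a msq j *ᵥ ψ) ≤ a * (ψ ⬝ᵥ ψ)) ∧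
      (∀ ψ : Site P j → ℝ, Q P j *ᵥ ψ = 0 → gamma115u P.L a * (ψ ⬝ᵥ ψ) ≤ ψ ⬝ᵥ (Drs P a msq j *ᵥ ψ)) :=
  ⟨gamma115u_pos ha (one_lt_cast_L P),
    fun ψ => ⟨form_Drs_nonneg ha hm hj ψ, form_Drs_le_a ha hm hj ψ⟩,
    fun ψ hψ => form_Drs_ge_of_Q_zero ha hm hj ψ hψ⟩

/-- **THE RATIO, NOTHING DIVIDED**: for every level `j ≥ 1`, every `φ` and every `ψ ∈ ker Q_j`,
`γ_u·⟨φ, Δ^{(j)}φ⟩·‖ψ‖² ≤ a·⟨ψ, Δ^{(j)}ψ⟩·‖φ‖²` — the ceiling at `φ` against the floor at `ψ` with the level-free pair `(a, γ_u)`. [folklore] -/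
theorem softTower_regionRatio {a msq : ℝ} (ha : 0 < a) (hm : 0 ≤ msq) {j : ℕ} (hj : 1 ≤ j) (φ ψ : Site P j → ℝ)
    (hψ : Q P j *ᵥ ψ = 0) :
    gamma115u P.L a * (φ ⬝ᵥ (Drs P a msq j *ᵥ φ)) * (ψ ⬝ᵥ ψ)
      ≤ a * (ψ ⬝ᵥ (Drs P a msq j *ᵥ ψ)) * (φ ⬝ᵥ φ) := by
  have h1 := form_Drs_le_a ha hm hj φ
  have h2 := form_Drs_ge_of_Q_zero ha hm hj ψ hψ
  have hγ := (gamma115u_pos ha (one_lt_cast_L P)).le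
  have hφ := dot_self_nonneg φ
  have hDφ := form_Drs_nonneg ha hm hj φ
  calc gamma115u P.L a * (φ ⬝ᵥ (Drs P a msq j *ᵥ φ)) * (ψ ⬝ᵥ ψ)
      = (φ ⬝ᵥ (Drs P a msq j *ᵥ φ)) * (gamma115u P.L a * (ψ ⬝ᵥ ψ)) := by ring
    _ ≤ (a * (φ ⬝ᵥ φ)) * (ψ ⬝ᵥ (Drs P a msq j *ᵥ ψ)) :=
        mul_le_mul h1 h2 (mul_nonneg hγ (dot_self_nonneg ψ)) (mul_nonneg ha.le hφ)
    _ = a * (ψ ⬝ᵥ (Drs P a msq j *ᵥ ψ)) * (φ ⬝ᵥ φ) := by ring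

/-! ## §4. Toy: the level-free ratio at `L = 2` -/

/-- At `L = 2`: `γ_u(2, a)⁻¹ = 64∕(3·min 8 a) + 8∕(3a)`, so the ratio bound `a∕γ_u(2,a) = 64a∕(3·min 8 a) + 8∕3` — equal to `24` for every
`0 < a ≤ 8` (against the HARD flow's exact `x_B* = 25.177` of the pricing desk, and `…FreeFieldBlockingLetters`' uniform certificate `< 1504`). -/
theorem ratio_L2 {a : ℝ} (ha : 0 < a) (ha8 : a ≤ 8) : a / gamma115u 2 a = 24 := by
  have hmin : min 8 a = a := min_eq_right ha8
  unfold gamma115u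
  rw [hmin]
  field_simp
  ring

example : (8 : ℝ) / gamma115u 2 8 = 24 := ratio_L2 (by norm_num) le_rfl

end Summit.QuantumFields.BalabanUV.T4Continuum.NE7b.SoftTowerRegionLetters
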